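import Literature.Computability.AlgebraicComplexity.OrbitCoordinateRing
import HarnessLib

/-!
# Counting the monomials invariant under a non-scalar diagonal substitution

The combinatorial core of the dimension count behind "almost all forms `w ∈ Sym^D ℂ^m` have a
trivial stabilizer" (Matsumura–Monsky 1964, as quoted in Bürgisser–Ikenmeyer 2017 §2.1 and
Poonen 2005 Thm. 3). For a tuple `c ∈ (K^×)^m` that is not constant, let
`S_c = {e : |e| = D, c^e = 1}` be the degree-`D` monomials invariant under `diag(c)` and
`F(c) = #{(i,j) : c_i ≠ c_j}` the number of ordered pairs of indices with different eigenvalues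
(the dimension of `GL_m` modulo the centraliser of `diag(c)`). Then

  `#S_c + F(c) < #{e : |e| = D}`   for `D ≥ 3`, `m ≥ 3`, `(D,m) ≠ (3,3)`

(`card_invariant_add_card_cross_lt`). Proof (ours; the printed sources argue by dimension of
varieties): an explicit injection `ι` of the cross pairs into the NON-invariant ("bad")
monomials — `(i,j) ↦ x_i^{D-1} x_j` when that monomial is bad, and otherwise `x_i^D` for the least
such `j` and `x_i^{D-2} x_{j₀} x_j` for the others — together with one more bad monomial outside
its range, found by a case analysis (`x_i^{D-2} x_j^2`, `x_i^D`, or a product of three variables).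
The sharp cases are plane cubics `(D,m) = (3,3)` (every plane cubic has an involution) and
quadrics, where the inequality fails.

Consumer: `GenericTrivialStabilizerProofs.lean` (discharge of
`BI2017_matsumuraMonsky_trivialStabilizer`). No definitions beyond private plumbing; no facts.
Honest framing: elementary counting; nothing here bears on VP versus VNP.
[cite: BurgisserIkenmeyer2017, §2.1 ("almost all w ∈ Sym^D ℂ^m have a trivial stabilizer")]

## References

* P. Bürgisser, C. Ikenmeyer, *Fundamental invariants of orbit closures*, J. Algebra 477 (2017),
  §2.1. [BurgisserIkenmeyer2017]
* H. Matsumura, P. Monsky, *On the automorphisms of hypersurfaces*, J. Math. Kyoto Univ. 3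
  (1963/64) 347–361. [MatsumuraMonsky1963]
-/

noncomputable section

namespace Literature.Computability.AlgebraicComplexity

namespace InvariantMonomialCount

variable {m : ℕ} {K : Type*} [Field K] (c : Fin m → K) (D : ℕ)

/-! ### Characters of monomials -/

/-- The character value `c^e = ∏ c_i^{e_i}` of the monomial `x^e` under `diag(c)`. [folklore] -/
private def chi (e : Fin m →₀ ℕ) : K := e.prod fun i k => c i ^ k

/-- `c^{e+e'} = c^e c^{e'}`. [folklore] -/
private theorem chi_add (e₁ e₂ : Fin m →₀ ℕ) : chi c (e₁ + e₂) = chi c e₁ * chi c e₂ :=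
  Finsupp.prod_add_index' (fun i => pow_zero (c i)) fun i a b => pow_add (c i) a b

/-- `c^{k ε_i} = c_i^k`. [folklore] -/
private theorem chi_single (i : Fin m) (k : ℕ) : chi c (Finsupp.single i k) = c i ^ k :=
  Finsupp.prod_single_index (pow_zero (c i))

/-! ### The monomials used by the injection -/

/-- `x_i^{D-1} x_j`. [folklore] -/
private def mA (i j : Fin m) : Fin m →₀ ℕ := Finsupp.single i (D - 1) + Finsupp.single j 1

/-- `x_i^D`. [folklore] -/
private def mB (i : Fin m) : Fin m →₀ ℕ := Finsupp.single i D

/-- `x_i^{D-2} x_{j₀} x_j`. [folklore] -/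
private def mE (i j₀ j : Fin m) : Fin m →₀ ℕ := Finsupp.single i (D - 2) + Finsupp.single j₀ 1 + Finsupp.single j 1

/-- `x_i^{D-2} x_j^2`. [folklore] -/
private def mF (i j : Fin m) : Fin m →₀ ℕ := Finsupp.single i (D - 2) + Finsupp.single j 2

/-- Exponents of `x_i^{D-1} x_j`. [folklore] -/
private theorem mA_apply (i j x : Fin m) :
    mA D i j x = (if i = x then D - 1 else 0) + (if j = x then 1 else 0) := by
  simp only [mA, Finsupp.coe_add, Pi.add_apply, Finsupp.single_apply]

/-- Exponents of `x_i^D`. [folklore] -/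
private theorem mB_apply (i x : Fin m) : mB D i x = if i = x then D else 0 := by
  simp only [mB, Finsupp.single_apply]

/-- Exponents of `x_i^{D-2} x_{j₀} x_j`. [folklore] -/
private theorem mE_apply (i j₀ j x : Fin m) :
    mE D i j₀ j x =
      (if i = x then D - 2 else 0) + (if j₀ = x then 1 else 0) + (if j = x then 1 else 0) := by
  simp only [mE, Finsupp.coe_add, Pi.add_apply, Finsupp.single_apply]

/-- Exponents of `x_i^{D-2} x_j^2`. [folklore] -/
private theorem mF_apply (i j x : Fin m) :
    mF D i j x = (if i = x then D - 2 else 0) + (if j = x then 2 else 0) := by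
  simp only [mF, Finsupp.coe_add, Pi.add_apply, Finsupp.single_apply]

/-- `x_i^{D-1} x_j` has degree `D`. [folklore] -/
private theorem degree_mA (hD : 1 ≤ D) (i j : Fin m) : (mA D i j).degree = D := by
  rw [mA, map_add, Finsupp.degree_single, Finsupp.degree_single]; omega

/-- `x_i^D` has degree `D`. [folklore] -/
private theorem degree_mB (i : Fin m) : (mB D i).degree = D := by
  rw [mB, Finsupp.degree_single]

/-- `x_i^{D-2} x_{j₀} x_j` has degree `D`. [folklore] -/
private theorem degree_mE (hD : 2 ≤ D) (i j₀ j : Fin m) : (mE D i j₀ j).degree = D := by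
  rw [mE, map_add, map_add, Finsupp.degree_single, Finsupp.degree_single, Finsupp.degree_single]; omega

/-- `x_i^{D-2} x_j^2` has degree `D`. [folklore] -/
private theorem degree_mF (hD : 2 ≤ D) (i j : Fin m) : (mF D i j).degree = D := by
  rw [mF, map_add, Finsupp.degree_single, Finsupp.degree_single]; omega

/-- Character of `x_i^{D-1} x_j`. [folklore] -/
private theorem chi_mA (i j : Fin m) : chi c (mA D i j) = c i ^ (D - 1) * c j := by
  rw [mA, chi_add, chi_single, chi_single, pow_one]

/-- Character of `x_i^D`. [folklore] -/
private theorem chi_mB (i : Fin m) : chi c (mB D i) = c i ^ D := by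
  rw [mB, chi_single]

/-- Character of `x_i^{D-2} x_{j₀} x_j`. [folklore] -/
private theorem chi_mE (i j₀ j : Fin m) : chi c (mE D i j₀ j) = c i ^ (D - 2) * c j₀ * c j := by
  rw [mE, chi_add, chi_add, chi_single, chi_single, chi_single, pow_one, pow_one]

/-- Character of `x_i^{D-2} x_j^2`. [folklore] -/
private theorem chi_mF (i j : Fin m) : chi c (mF D i j) = c i ^ (D - 2) * c j ^ 2 := by
  rw [mF, chi_add, chi_single, chi_single]

/-! ### Eigenvalue algebra -/

section Algebra

variable {c D}

/-- `c_i^{D-1} c_j = 1 = c_i^D` forces `c_i = c_j`. [folklore] -/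
private theorem eq_of_goodA_of_goodB (hc : ∀ i, c i ≠ 0) (hD : 1 ≤ D) {i j : Fin m}
    (hA : c i ^ (D - 1) * c j = 1) (hB : c i ^ D = 1) : c i = c j := by
  have h : c i ^ (D - 1) * c i = c i ^ (D - 1) * c j := by
    rw [← pow_succ, Nat.sub_add_cancel hD, hB, hA]
  exact mul_left_cancel₀ (pow_ne_zero _ (hc i)) h

/-- `c_i^{D-1} c_j = 1 = c_i^{D-1} c_{j'}` forces `c_j = c_{j'}`. [folklore] -/
private theorem eq_of_goodA_of_goodA (hc : ∀ i, c i ≠ 0) {i j j' : Fin m}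
    (h : c i ^ (D - 1) * c j = 1) (h' : c i ^ (D - 1) * c j' = 1) : c j = c j' :=
  mul_left_cancel₀ (pow_ne_zero _ (hc i)) (h.trans h'.symm)

/-- `c_i^{D-1} c_{j₀} = 1 = c_i^{D-2} c_{j₀} c_j` forces `c_i = c_j`. [folklore] -/
private theorem eq_of_goodA_of_goodE (hc : ∀ i, c i ≠ 0) (hD : 2 ≤ D) {i j₀ j : Fin m}
    (hA : c i ^ (D - 1) * c j₀ = 1) (hE : c i ^ (D - 2) * c j₀ * c j = 1) : c i = c j := by
  have h : c i ^ (D - 2) * c j₀ * c i = c i ^ (D - 2) * c j₀ * c j := by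
    rw [hE, mul_right_comm, ← pow_succ, show D - 2 + 1 = D - 1 by omega, hA]
  exact mul_left_cancel₀ (mul_ne_zero (pow_ne_zero _ (hc i)) (hc j₀)) h

/-- `c_i^{D-1} c_j = 1 = c_i^{D-2} c_j^2` forces `c_i = c_j`. [folklore] -/
private theorem eq_of_goodA_of_goodF (hc : ∀ i, c i ≠ 0) (hD : 2 ≤ D) {i j : Fin m}
    (hA : c i ^ (D - 1) * c j = 1) (hF : c i ^ (D - 2) * c j ^ 2 = 1) : c i = c j :=
  eq_of_goodA_of_goodE hc hD hA (by rw [mul_assoc, ← sq]; exact hF)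

end Algebra

/-! ### The injection of cross pairs into bad monomials -/

variable [DecidableEq K]

/-- The indices `j` with `x_i^{D-1} x_j` invariant. [folklore] -/
private def bset (i : Fin m) : Finset (Fin m) :=
  Finset.univ.filter fun j => c i ^ (D - 1) * c j = 1

/-- The least index `j₀` with `x_i^{D-1} x_{j₀}` invariant (or `i` if there is none). [folklore] -/
private def jz (i : Fin m) : Fin m :=
  if h : (bset c D i).Nonempty then (bset c D i).min' h else i

/-- If some `x_i^{D-1} x_j` is invariant then so is `x_i^{D-1} x_{j₀(i)}`. [folklore] -/
private theorem jz_spec {i j : Fin m} (hj : c i ^ (D - 1) * c j = 1) :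
    c i ^ (D - 1) * c (jz c D i) = 1 := by
  have hne : (bset c D i).Nonempty := ⟨j, by simp [bset, hj]⟩
  have hmem := Finset.min'_mem _ hne
  rw [jz, dif_pos hne]
  simpa [bset] using hmem

/-- The injection `ι`: `(i,j) ↦ x_i^{D-1} x_j` if that monomial is not invariant; otherwise
`x_i^D` for `j = j₀(i)` and `x_i^{D-2} x_{j₀(i)} x_j` for the other `j`. [folklore] -/
private def iota (q : Fin m × Fin m) : Fin m →₀ ℕ :=
  if c q.1 ^ (D - 1) * c q.2 = 1 then
    (if q.2 = jz c D q.1 then mB D q.1 else mE D q.1 (jz c D q.1) q.2)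
  else mA D q.1 q.2

/-- The three shapes of `ι(i,j)` for a cross pair, with the side information used later.
[folklore] -/
private theorem iota_cases (hc : ∀ i, c i ≠ 0) (hD : 1 ≤ D) {i j : Fin m} (hij : c i ≠ c j) :
    (c i ^ (D - 1) * c j ≠ 1 ∧ iota c D (i, j) = mA D i j) ∨
    (c i ^ (D - 1) * c j = 1 ∧ j = jz c D i ∧ iota c D (i, j) = mB D i) ∨
    (c i ^ (D - 1) * c j = 1 ∧ j ≠ jz c D i ∧ iota c D (i, j) = mE D i (jz c D i) j ∧
      c (jz c D i) = c j ∧ jz c D i ≠ i ∧ c i ^ D ≠ 1) := by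
  unfold iota
  by_cases hA : c i ^ (D - 1) * c j = 1
  · have hz := jz_spec c D hA
    have hcz : c (jz c D i) = c j := eq_of_goodA_of_goodA hc hz hA
    by_cases hj : j = jz c D i
    · exact Or.inr (Or.inl ⟨hA, hj, by rw [if_pos hA, if_pos hj]⟩)
    · refine Or.inr (Or.inr ⟨hA, hj, by rw [if_pos hA, if_neg hj], hcz, ?_, fun hB => hij ?_⟩)
      · intro h; exact hij (by rw [← hcz, h])
      · exact eq_of_goodA_of_goodB hc hD hA hB
  · exact Or.inl ⟨hA, by rw [if_neg hA]⟩

/-! ### Bad monomials and cross pairs -/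

/-- The degree-`D` monomials NOT invariant under `diag(c)`. [folklore] -/
private def bad : Finset (Fin m →₀ ℕ) := (degMonomials (Fin m) D).filter fun e => chi c e ≠ 1

/-- The ordered pairs of indices with different eigenvalues. [folklore] -/
private def cross : Finset (Fin m × Fin m) := Finset.univ.filter fun q => c q.1 ≠ c q.2

/-- Membership in `bad`. [folklore] -/
private theorem mem_bad_iff {e : Fin m →₀ ℕ} : e ∈ bad c D ↔ e.degree = D ∧ chi c e ≠ 1 := by
  rw [bad, Finset.mem_filter, mem_degMonomials_iff]

omit [Field K] in
/-- Membership in `cross`. [folklore] -/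
private theorem mem_cross_iff {q : Fin m × Fin m} : q ∈ cross c ↔ c q.1 ≠ c q.2 := by
  rw [cross, Finset.mem_filter, and_iff_right (Finset.mem_univ q)]

/-- `ι` maps cross pairs to bad monomials. [folklore] -/
private theorem iota_mem_bad (hc : ∀ i, c i ≠ 0) (hD : 2 ≤ D) {i j : Fin m} (hij : c i ≠ c j) :
    iota c D (i, j) ∈ bad c D := by
  rw [mem_bad_iff]
  rcases iota_cases c D hc (by omega) hij with ⟨hA, h⟩ | ⟨hA, -, h⟩ | ⟨hA, -, h, -, -, hB⟩
  · rw [h, chi_mA]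
    exact ⟨degree_mA D (by omega) i j, hA⟩
  · rw [h, chi_mB]
    exact ⟨degree_mB D i, fun hB => hij (eq_of_goodA_of_goodB hc (by omega) hA hB)⟩
  · rw [h, chi_mE]
    exact ⟨degree_mE D hD _ _ _, fun hE => hij (eq_of_goodA_of_goodE hc hD (jz_spec c D hA) hE)⟩

/-- Only the first index of a cross pair can carry an exponent `≥ 2` in `ι(i,j)`. [folklore] -/
private theorem eq_of_two_le_iota (hc : ∀ i, c i ≠ 0) (hD : 1 ≤ D) {i j : Fin m} (hij : c i ≠ c j)
    {x : Fin m} (hx : 2 ≤ iota c D (i, j) x) : x = i := by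
  rcases iota_cases c D hc hD hij with ⟨-, h⟩ | ⟨-, -, h⟩ | ⟨-, hj, h, -⟩
  · rw [h, mA_apply] at hx
    split_ifs at hx with h1 h2 <;> first | exact h1.symm | omega
  · rw [h, mB_apply] at hx
    split_ifs at hx with h1 <;> first | exact h1.symm | omega
  · rw [h, mE_apply] at hx
    split_ifs at hx with h1 h2 h3 <;> first | exact h1.symm | (exact absurd (h3.trans h2.symm) hj) | omega

/-- The exponent of `x_i` in `ι(i,j)` tells the shape: `D-1`, `D` or `D-2`. [folklore] -/
private theorem iota_apply_fst (hc : ∀ i, c i ≠ 0) (hD : 1 ≤ D) {i j : Fin m} (hij : c i ≠ c j) :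
    (c i ^ (D - 1) * c j ≠ 1 ∧ iota c D (i, j) i = D - 1) ∨
    (c i ^ (D - 1) * c j = 1 ∧ j = jz c D i ∧ iota c D (i, j) i = D) ∨
    (c i ^ (D - 1) * c j = 1 ∧ j ≠ jz c D i ∧ iota c D (i, j) i = D - 2) := by
  have hji : j ≠ i := fun h => hij (by rw [h])
  rcases iota_cases c D hc hD hij with ⟨hA, h⟩ | ⟨hA, hj, h⟩ | ⟨hA, hj, h, -, hzi, -⟩
  · refine Or.inl ⟨hA, ?_⟩
    rw [h, mA_apply, if_pos rfl, if_neg hji, add_zero]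
  · refine Or.inr (Or.inl ⟨hA, hj, ?_⟩)
    rw [h, mB_apply, if_pos rfl]
  · refine Or.inr (Or.inr ⟨hA, hj, ?_⟩)
    rw [h, mE_apply, if_pos rfl, if_neg hzi, if_neg hji, add_zero, add_zero]

/-- From `1 ≤ [p] + [q]` (indicators in `ℕ`) conclude `p ∨ q`. [folklore] -/
private theorem or_of_one_le_ite_add_ite {p q : Prop} [Decidable p] [Decidable q]
    (h : 1 ≤ (if p then 1 else 0) + (if q then 1 else 0)) : p ∨ q := by
  by_cases hp : p
  · exact Or.inl hp
  by_cases hq : q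
  · exact Or.inr hq
  rw [if_neg hp, if_neg hq] at h
  omega

/-- `ι` is injective on cross pairs (`D ≥ 3`). [folklore] -/
private theorem iota_injOn (hc : ∀ i, c i ≠ 0) (hD : 3 ≤ D) :
    Set.InjOn (iota c D) ↑(cross c) := by
  rintro ⟨i, j⟩ hq ⟨i', j'⟩ hq' heq
  rw [Finset.mem_coe, mem_cross_iff] at hq hq'
  dsimp only at hq hq'
  have hji : j ≠ i := fun h => hq (by rw [h])
  have hji' : j' ≠ i' := fun h => hq' (by rw [h])
  -- Step 1: the first indices agree
  have hii : i = i' := by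
    by_cases h2 : 2 ≤ iota c D (i, j) i
    · rw [heq] at h2
      exact eq_of_two_le_iota c D hc (by omega) hq' h2
    by_cases h2' : 2 ≤ iota c D (i', j') i'
    · rw [← heq] at h2'
      exact (eq_of_two_le_iota c D hc (by omega) hq h2').symm
    -- both are of the shape `x_i x_{j₀} x_j` with `D = 3`
    rcases iota_cases c D hc (by omega) hq with ⟨-, h⟩ | ⟨-, -, h⟩ | ⟨hA, hj, h, hcz, hzi, -⟩
    · rw [h, mA_apply, if_pos rfl] at h2; omega
    · rw [h, mB_apply, if_pos rfl] at h2; omega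
    rcases iota_cases c D hc (by omega) hq' with ⟨-, h'⟩ | ⟨-, -, h'⟩ | ⟨hA', hj', h', hcz', hzi', -⟩
    · rw [h', mA_apply, if_pos rfl] at h2'; omega
    · rw [h', mB_apply, if_pos rfl] at h2'; omega
    rw [h, mE_apply, if_pos rfl] at h2
    have hD3 : D - 2 = 1 := by omega
    rw [h, h'] at heq
    by_contra hne
    have ev : ∀ x, (if i = x then 1 else 0) + (if jz c D i = x then 1 else 0) +
        (if j = x then 1 else 0) = (if i' = x then 1 else 0) +
        (if jz c D i' = x then 1 else 0) + (if j' = x then 1 else 0) := fun x => by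
      have e := DFunLike.congr_fun heq x
      rwa [mE_apply, mE_apply, hD3] at e
    -- at `i'`: `j₀ = i'` or `j = i'`, so `c i' = c j`
    have e1 := ev i'
    rw [if_neg hne, if_pos rfl, if_neg hzi', if_neg hji'] at e1
    have hc1 : c i' = c j := by
      rcases or_of_one_le_ite_add_ite (p := jz c D i = i') (q := j = i') (by omega) with h3 | h3
      · rw [← h3, hcz]
      · rw [← h3]
    -- at `i`: `j₀' = i` or `j' = i`, so `c i = c j'`
    have e2 := ev i
    rw [if_pos rfl, if_neg hzi, if_neg hji, if_neg (Ne.symm hne)] at e2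
    have hc2 : c i = c j' := by
      rcases or_of_one_le_ite_add_ite (p := jz c D i' = i) (q := j' = i) (by omega) with h3 | h3
      · rw [← h3, hcz']
      · rw [← h3]
    -- at the element `t` of `{j₀, j}` other than `i'`: `c t = c j'`
    have key : ∀ t : Fin m, t ≠ i' → c t = c j → (jz c D i = t ∨ j = t) → False := by
      intro t hti' hct hmem
      have hit : i ≠ t := fun h => hq (by rw [h, hct])
      have e3 := ev t
      rw [if_neg hit, if_neg (Ne.symm hti')] at e3
      have h1 : 1 ≤ (if jz c D i = t then 1 else 0) + (if j = t then 1 else 0) := by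
        rcases hmem with h4 | h4
        · rw [if_pos h4]; omega
        · rw [if_pos h4]; omega
      have hct' : c t = c j' := by
        rcases or_of_one_le_ite_add_ite (p := jz c D i' = t) (q := j' = t) (by omega) with h3 | h3
        · rw [← h3, hcz']
        · rw [← h3]
      exact hq (by rw [hc2, ← hct', hct])
    by_cases hzi'' : jz c D i = i'
    · exact key j (fun h => hj (h.trans hzi''.symm)) rfl (Or.inr rfl)
    · exact key (jz c D i) hzi'' hcz (Or.inl rfl)
  -- Step 2: same first index, hence same shape, hence same second index
  subst hii
  have hv := DFunLike.congr_fun heq i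
  rcases iota_apply_fst c D hc (by omega) hq with ⟨hA, hvi⟩ | ⟨hA, hj, hvi⟩ | ⟨hA, hj, hvi⟩ <;>
    rcases iota_apply_fst c D hc (by omega) hq' with ⟨hA', hvi'⟩ | ⟨hA', hj', hvi'⟩ | ⟨hA', hj', hvi'⟩ <;>
    rw [hvi, hvi'] at hv <;> (try omega)
  · -- A / A
    rcases iota_cases c D hc (by omega) hq with ⟨-, h⟩ | ⟨h, -⟩ | ⟨h, -⟩ <;> try exact absurd h hA
    rcases iota_cases c D hc (by omega) hq' with ⟨-, h'⟩ | ⟨h', -⟩ | ⟨h', -⟩ <;> try exact absurd h' hA'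
    have hw := DFunLike.congr_fun heq j
    rw [h, h', mA_apply, mA_apply, if_neg hji.symm, if_pos rfl] at hw
    by_cases h1 : j' = j
    · rw [h1]
    · rw [if_neg h1] at hw; omega
  · -- B / B
    rw [hj, hj']
  · -- E / E
    rcases iota_cases c D hc (by omega) hq with ⟨h, -⟩ | ⟨-, h, -⟩ | ⟨-, -, h, -, hzi, -⟩
    · exact absurd hA h
    · exact absurd h hj
    rcases iota_cases c D hc (by omega) hq' with ⟨h', -⟩ | ⟨-, h', -⟩ | ⟨-, -, h', -⟩
    · exact absurd hA' h'
    · exact absurd h' hj'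
    have hw := DFunLike.congr_fun heq j
    rw [h, h', mE_apply, mE_apply, if_neg hji.symm, if_neg (Ne.symm hj), if_pos rfl] at hw
    by_cases h1 : j' = j
    · rw [h1]
    · rw [if_neg h1] at hw; omega

/-! ### One more bad monomial outside the range of `ι` -/

/-- From `1 ≤ [p] + [q] + [r]` conclude `p ∨ q ∨ r`. [folklore] -/
private theorem or_of_one_le_ite_add_ite_add_ite {p q r : Prop} [Decidable p] [Decidable q]
    [Decidable r] (h : 1 ≤ (if p then 1 else 0) + (if q then 1 else 0) + (if r then 1 else 0)) :
    p ∨ q ∨ r := by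
  by_cases hp : p
  · exact Or.inl hp
  by_cases hq : q
  · exact Or.inr (Or.inl hq)
  by_cases hr : r
  · exact Or.inr (Or.inr hr)
  rw [if_neg hp, if_neg hq, if_neg hr] at h
  omega

/-- Three indicators of pairwise incompatible equalities sum to at most `1`. [folklore] -/
private theorem ite_add_ite_add_ite_le_one {x y z w : Fin m} (hxy : x ≠ y) (hxz : x ≠ z)
    (hyz : y ≠ z) :
    (if x = w then 1 else 0) + (if y = w then 1 else 0) + (if z = w then 1 else 0) ≤ 1 := by
  by_cases h1 : x = w
  · subst h1; rw [if_pos rfl, if_neg (Ne.symm hxy), if_neg (Ne.symm hxz)]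
  rw [if_neg h1]
  by_cases h2 : y = w
  · subst h2; rw [if_pos rfl, if_neg (Ne.symm hyz)]
  rw [if_neg h2]
  split_ifs <;> omega

/-- A monomial with two exponents `≥ 2` is not in the range of `ι`. [folklore] -/
private theorem iota_ne_of_two_le_two (hc : ∀ i, c i ≠ 0) (hD : 1 ≤ D) {e : Fin m →₀ ℕ}
    {x y : Fin m} (hxy : x ≠ y) (hx : 2 ≤ e x) (hy : 2 ≤ e y) {a b : Fin m} (hab : c a ≠ c b) :
    iota c D (a, b) ≠ e := by
  intro h
  have h1 := eq_of_two_le_iota c D hc hD hab (x := x) (by rw [h]; exact hx)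
  have h2 := eq_of_two_le_iota c D hc hD hab (x := y) (by rw [h]; exact hy)
  exact hxy (h1.trans h2.symm)

/-- In the absence of invariant `x_a^{D-1} x_b` (`a, b` a cross pair), `ι(a,b) = x_a^{D-1} x_b`.
[folklore] -/
private theorem iota_eq_mA {a b : Fin m} (h : c a ^ (D - 1) * c b ≠ 1) :
    iota c D (a, b) = mA D a b := by
  unfold iota
  rw [if_neg h]

/-- A product of three distinct variables (degree `3`) is not `ι(a,b)` unless `ι(a,b)` has the third
shape. [folklore] -/
private theorem iota_eq_mE_of_eq_triple (hc : ∀ i, c i ≠ 0) (hD3 : D = 3) {x y z : Fin m}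
    (hxy : x ≠ y) (hxz : x ≠ z) (hyz : y ≠ z) {a b : Fin m} (hab : c a ≠ c b)
    (h : iota c D (a, b) = mE D x y z) :
    c a ^ (D - 1) * c b = 1 ∧ b ≠ jz c D a ∧ iota c D (a, b) = mE D a (jz c D a) b ∧
      c (jz c D a) = c b ∧ jz c D a ≠ a := by
  have hle : ∀ w, mE D x y z w ≤ 1 := fun w => by
    rw [mE_apply, show D - 2 = 1 by omega]
    exact ite_add_ite_add_ite_le_one hxy hxz hyz
  rcases iota_apply_fst c D hc (by omega) hab with ⟨-, hv⟩ | ⟨-, -, hv⟩ | ⟨hA, hj, -⟩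
  · have := hle a; rw [← h, hv] at this; omega
  · have := hle a; rw [← h, hv] at this; omega
  rcases iota_cases c D hc (by omega) hab with ⟨h', -⟩ | ⟨-, h', -⟩ | ⟨-, -, h', hcz, hza, -⟩
  · exact absurd hA h'
  · exact absurd h' hj
  exact ⟨hA, hj, h', hcz, hza⟩

/-- Support of `x_a x_{z} x_b = x_x x_y x_z'`: each of `a, z, b` is one of `x, y, z'`. [folklore] -/
private theorem mem_of_mE_eq_mE (hD3 : D - 2 = 1) {a z b x y z' : Fin m}
    (h : mE D a z b = mE D x y z') {w : Fin m} (hw : w = a ∨ w = z ∨ w = b) :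
    x = w ∨ y = w ∨ z' = w := by
  have e := DFunLike.congr_fun h w
  rw [mE_apply, mE_apply, hD3] at e
  refine or_of_one_le_ite_add_ite_add_ite ?_
  rw [← e]
  rcases hw with h1 | h1 | h1 <;> rw [h1] <;> rw [if_pos rfl] <;> omega

/-- `m ≥ 3`: a third index. [folklore] -/
private theorem exists_ne_ne (hm : 3 ≤ m) (i j : Fin m) : ∃ k : Fin m, k ≠ i ∧ k ≠ j := by
  classical
  have h : ({i, j} : Finset (Fin m)).card < (Finset.univ : Finset (Fin m)).card :=
    lt_of_le_of_lt (Finset.card_le_two) (by rw [Finset.card_univ, Fintype.card_fin]; omega)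
  obtain ⟨k, -, hk⟩ := Finset.exists_mem_notMem_of_card_lt_card h
  exact ⟨k, fun h => hk (by simp [h]), fun h => hk (by simp [h])⟩

/-- `m ≥ 4`: a fourth index. [folklore] -/
private theorem exists_ne_ne_ne (hm : 4 ≤ m) (i j k : Fin m) :
    ∃ l : Fin m, l ≠ i ∧ l ≠ j ∧ l ≠ k := by
  classical
  have h : ({i, j, k} : Finset (Fin m)).card < (Finset.univ : Finset (Fin m)).card :=
    lt_of_le_of_lt (Finset.card_le_three) (by rw [Finset.card_univ, Fintype.card_fin]; omega)
  obtain ⟨l, -, hl⟩ := Finset.exists_mem_notMem_of_card_lt_card h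
  exact ⟨l, fun h => hl (by simp [h]), fun h => hl (by simp [h]), fun h => hl (by simp [h])⟩

/-- **Case I, `D ≥ 4`**: if some cross `x_i^{D-1} x_j` is invariant, `x_i^{D-2} x_j^2` is a bad
monomial outside the range of `ι`. [folklore] -/
private theorem extra_caseI_four (hc : ∀ i, c i ≠ 0) (hD : 4 ≤ D) {i j : Fin m} (hij : c i ≠ c j)
    (hA : c i ^ (D - 1) * c j = 1) : ∃ e ∈ bad c D, ∀ q ∈ cross c, iota c D q ≠ e := by
  have hji : i ≠ j := fun h => hij (by rw [h])
  refine ⟨mF D i j, (mem_bad_iff c D).mpr ⟨degree_mF D (by omega) i j, fun hF => hij ?_⟩, ?_⟩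
  · rw [chi_mF] at hF
    exact eq_of_goodA_of_goodF hc (by omega) hA hF
  · rintro ⟨a, b⟩ hq
    rw [mem_cross_iff] at hq
    refine iota_ne_of_two_le_two c D hc (by omega) hji ?_ ?_ hq
    · rw [mF_apply, if_pos rfl]; omega
    · rw [mF_apply, if_neg hji, if_pos rfl]

/-- **Case II, `D ≥ 4`** (no cross `x_a^{D-1} x_b` invariant; `m ≥ 3`). [folklore] -/
private theorem extra_caseII_four (hc : ∀ i, c i ≠ 0) (hD : 4 ≤ D) (hm : 3 ≤ m)
    (hII : ∀ a b : Fin m, c a ≠ c b → c a ^ (D - 1) * c b ≠ 1) {i j : Fin m} (hij : c i ≠ c j) :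
    ∃ e ∈ bad c D, ∀ q ∈ cross c, iota c D q ≠ e := by
  have hji : i ≠ j := fun h => hij (by rw [h])
  obtain ⟨k, hki, hkj⟩ := exists_ne_ne hm i j
  -- the four candidates; none is in the range of `ι`
  have hF : ∀ {x y : Fin m}, x ≠ y → ∀ q ∈ cross c, iota c D q ≠ mF D x y := by
    rintro x y hxy ⟨a, b⟩ hq
    rw [mem_cross_iff] at hq
    refine iota_ne_of_two_le_two c D hc (by omega) hxy ?_ ?_ hq
    · rw [mF_apply, if_pos rfl]; omega
    · rw [mF_apply, if_neg hxy, if_pos rfl]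
  have hE : ∀ {x y : Fin m}, x ≠ y → k ≠ x → k ≠ y → c x ≠ c y →
      ∀ q ∈ cross c, iota c D q ≠ mE D x y k := by
    rintro x y hxy hkx hky hcxy ⟨a, b⟩ hq h
    rw [mem_cross_iff] at hq
    have hax : x = a := eq_of_two_le_iota c D hc (by omega) hq (x := x)
      (by rw [h, mE_apply, if_pos rfl]; omega)
    subst hax
    rw [iota_eq_mA c D (hII _ _ hq)] at h
    have e := DFunLike.congr_fun h x
    rw [mA_apply, mE_apply, if_pos rfl, if_neg (fun h' => hq (by rw [h'])), if_pos rfl,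
      if_neg (Ne.symm hxy), if_neg hkx] at e
    omega
  have hdeg : ∀ {x y : Fin m}, (mE D x y k).degree = D := fun {x y} => degree_mE D (by omega) _ _ _
  by_cases h1 : chi c (mF D i j) ≠ 1
  · exact ⟨_, (mem_bad_iff c D).mpr ⟨degree_mF D (by omega) i j, h1⟩, hF hji⟩
  by_cases h2 : chi c (mF D j i) ≠ 1
  · exact ⟨_, (mem_bad_iff c D).mpr ⟨degree_mF D (by omega) j i, h2⟩, hF hji.symm⟩
  by_cases h3 : chi c (mE D i j k) ≠ 1
  · exact ⟨_, (mem_bad_iff c D).mpr ⟨hdeg, h3⟩, hE hji hki hkj hij⟩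
  by_cases h4 : chi c (mE D j i k) ≠ 1
  · exact ⟨_, (mem_bad_iff c D).mpr ⟨hdeg, h4⟩, hE hji.symm hkj hki hij.symm⟩
  exfalso
  rw [not_not, chi_mF] at h1 h2
  rw [not_not, chi_mE] at h3 h4
  -- `c_j = c_k` and `c_i = c_k`
  have hjk : c j = c k := by
    have : c i ^ (D - 2) * c j * c j = c i ^ (D - 2) * c j * c k := by
      rw [h3, mul_assoc, ← sq, h1]
    exact mul_left_cancel₀ (mul_ne_zero (pow_ne_zero _ (hc i)) (hc j)) this
  have hik : c i = c k := by
    have : c j ^ (D - 2) * c i * c i = c j ^ (D - 2) * c i * c k := by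
      rw [h4, mul_assoc, ← sq, h2]
    exact mul_left_cancel₀ (mul_ne_zero (pow_ne_zero _ (hc j)) (hc i)) this
  exact hij (hik.trans hjk.symm)

/-- **Case II, `D = 3`** (no cross `x_a^2 x_b` invariant; `m ≥ 4`): a bad product of three
distinct variables. [folklore] -/
private theorem extra_caseII_three (hc : ∀ i, c i ≠ 0) (hD3 : D = 3) (hm : 4 ≤ m)
    (hII : ∀ a b : Fin m, c a ≠ c b → c a ^ (D - 1) * c b ≠ 1) {i j : Fin m} (hij : c i ≠ c j) :
    ∃ e ∈ bad c D, ∀ q ∈ cross c, iota c D q ≠ e := by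
  have hji : i ≠ j := fun h => hij (by rw [h])
  obtain ⟨k, hki, hkj⟩ := exists_ne_ne (by omega) i j
  obtain ⟨l, hli, hlj, hlk⟩ := exists_ne_ne_ne hm i j k
  -- a product of three distinct variables is never `x_a^2 x_b`
  have hT : ∀ {x y z : Fin m}, x ≠ y → x ≠ z → y ≠ z → ∀ q ∈ cross c, iota c D q ≠ mE D x y z := by
    rintro x y z hxy hxz hyz ⟨a, b⟩ hq h
    rw [mem_cross_iff] at hq
    rw [iota_eq_mA c D (hII _ _ hq)] at h
    have e := DFunLike.congr_fun h a
    rw [mA_apply, if_pos rfl, mE_apply, show D - 2 = 1 by omega] at e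
    have := ite_add_ite_add_ite_le_one (w := a) hxy hxz hyz
    omega
  have hdeg : ∀ {x y z : Fin m}, (mE D x y z).degree = D := fun {x y z} => degree_mE D (by omega) _ _ _
  by_cases h1 : chi c (mE D i j k) ≠ 1
  · exact ⟨_, (mem_bad_iff c D).mpr ⟨hdeg, h1⟩, hT hji hki.symm hkj.symm⟩
  by_cases h2 : chi c (mE D i j l) ≠ 1
  · exact ⟨_, (mem_bad_iff c D).mpr ⟨hdeg, h2⟩, hT hji hli.symm hlj.symm⟩
  by_cases h3 : chi c (mE D i k l) ≠ 1
  · exact ⟨_, (mem_bad_iff c D).mpr ⟨hdeg, h3⟩, hT hki.symm hli.symm hlk.symm⟩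
  by_cases h4 : chi c (mE D j k l) ≠ 1
  · exact ⟨_, (mem_bad_iff c D).mpr ⟨hdeg, h4⟩, hT hkj.symm hlj.symm hlk.symm⟩
  exfalso
  rw [not_not, chi_mE, hD3] at h1 h2 h3 h4
  norm_num at h1 h2 h3 h4
  have hkl : c k = c l :=
    mul_left_cancel₀ (mul_ne_zero (hc i) (hc j)) (h1.trans h2.symm)
  have hcij : c i = c j := by
    have : c i * (c k * c l) = c j * (c k * c l) := by
      rw [← mul_assoc, ← mul_assoc, h3, h4]
    exact mul_right_cancel₀ (mul_ne_zero (hc k) (hc l)) this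
  exact hij hcij

/-- **Case I.1, `D = 3`**: a cross `x_i^2 x_j` is invariant and the eigenvalue class of `i` has
another element `i'`: then `x_i^2 x_{i'}` is bad and outside the range. [folklore] -/
private theorem extra_caseI_three_1 (hc : ∀ i, c i ≠ 0) (hD3 : D = 3) {i j : Fin m}
    (hij : c i ≠ c j) (hA : c i ^ (D - 1) * c j = 1) {i' : Fin m} (hi'i : i' ≠ i)
    (hci' : c i' = c i) : ∃ e ∈ bad c D, ∀ q ∈ cross c, iota c D q ≠ e := by
  refine ⟨mA D i i', (mem_bad_iff c D).mpr ⟨degree_mA D (by omega) i i', fun h => hij ?_⟩, ?_⟩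
  · rw [chi_mA] at h
    rw [← hci', eq_of_goodA_of_goodA hc hA h]
  rintro ⟨a, b⟩ hq h
  rw [mem_cross_iff] at hq
  dsimp only at hq
  have hai : i = a := eq_of_two_le_iota c D hc (by omega) hq (x := i)
    (by rw [h, mA_apply, if_pos rfl]; omega)
  subst hai
  -- the shape of `ι(i,b)` is read off at `i`: it must be `x_i^2 x_b`
  have hv := DFunLike.congr_fun h i
  rw [mA_apply, if_pos rfl, if_neg hi'i] at hv
  rcases iota_apply_fst c D hc (by omega) hq with ⟨hA', -⟩ | ⟨-, -, hv'⟩ | ⟨-, -, hv'⟩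
  · rw [iota_eq_mA c D hA'] at h
    have hw := DFunLike.congr_fun h i'
    rw [mA_apply, mA_apply, if_neg (Ne.symm hi'i), if_pos rfl] at hw
    have hb : b = i' := by
      by_cases hb : b = i'
      · exact hb
      · rw [if_neg hb] at hw; omega
    exact hq (by rw [hb, hci'])
  · rw [hv'] at hv; omega
  · rw [hv'] at hv; omega

/-- **Case I.2, `D = 3`**: a cross `x_i^2 x_j` is invariant and there are two further indices
`j₁ ≠ j₂`, both different from `j₀(i)`, with `x_i^2 x_{j₁}`, `x_i^2 x_{j₂}` invariant: then
`x_i x_{j₁} x_{j₂}` is bad and outside the range. [folklore] -/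
private theorem extra_caseI_three_2 (hc : ∀ i, c i ≠ 0) (hD3 : D = 3) {i j : Fin m}
    (hij : c i ≠ c j) (hA : c i ^ (D - 1) * c j = 1) {j₁ j₂ : Fin m} (h12 : j₁ ≠ j₂)
    (h1z : j₁ ≠ jz c D i) (h2z : j₂ ≠ jz c D i) (hA1 : c i ^ (D - 1) * c j₁ = 1)
    (hA2 : c i ^ (D - 1) * c j₂ = 1) : ∃ e ∈ bad c D, ∀ q ∈ cross c, iota c D q ≠ e := by
  have hc1 : c j₁ = c j := eq_of_goodA_of_goodA hc hA1 hA
  have hc2 : c j₂ = c j := eq_of_goodA_of_goodA hc hA2 hA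
  have hi1 : i ≠ j₁ := fun h => hij (by rw [h, hc1])
  have hi2 : i ≠ j₂ := fun h => hij (by rw [h, hc2])
  refine ⟨mE D i j₁ j₂, (mem_bad_iff c D).mpr ⟨degree_mE D (by omega) _ _ _, fun h => hij ?_⟩, ?_⟩
  · rw [chi_mE] at h
    rw [← hc2]
    exact eq_of_goodA_of_goodE hc (by omega) hA1 h
  rintro ⟨a, b⟩ hq h
  rw [mem_cross_iff] at hq
  dsimp only at hq
  obtain ⟨hAab, hbz, hsh, hcz, hza⟩ := iota_eq_mE_of_eq_triple c D hc hD3 hi1 hi2 h12 hq h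
  rw [hsh] at h
  have hD2 : D - 2 = 1 := by omega
  -- `a ∈ {i, j₁, j₂}`
  rcases mem_of_mE_eq_mE D hD2 h (Or.inl rfl) with ha | ha | ha
  · -- `a = i`: then `j₀(i) ∈ {i, j₁, j₂}`, impossible
    subst ha
    rcases mem_of_mE_eq_mE D hD2 h (Or.inr (Or.inl rfl)) with hz | hz | hz
    · exact hza hz.symm
    · exact h1z hz
    · exact h2z hz
  · -- `a = j₁`: then `c a = c j`, and both `j₀(a)` and `b` must be `i`
    have hca : c a = c j := by rw [← ha, hc1]
    have hzi : jz c D a = i := by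
      rcases mem_of_mE_eq_mE D hD2 h (Or.inr (Or.inl rfl)) with hz | hz | hz
      · exact hz.symm
      · exact absurd (hcz.symm.trans (by rw [← hz, hc1, ← hca])) hq.symm
      · exact absurd (hcz.symm.trans (by rw [← hz, hc2, ← hca])) hq.symm
    have hbi : b = i := by
      rcases mem_of_mE_eq_mE D hD2 h (Or.inr (Or.inr rfl)) with hb | hb | hb
      · exact hb.symm
      · exact absurd (by rw [← hb, hc1, hca]) hq
      · exact absurd (by rw [← hb, hc2, hca]) hq
    exact hbz (hbi.trans hzi.symm)
  · -- `a = j₂`: symmetric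
    have hca : c a = c j := by rw [← ha, hc2]
    have hzi : jz c D a = i := by
      rcases mem_of_mE_eq_mE D hD2 h (Or.inr (Or.inl rfl)) with hz | hz | hz
      · exact hz.symm
      · exact absurd (hcz.symm.trans (by rw [← hz, hc1, ← hca])) hq.symm
      · exact absurd (hcz.symm.trans (by rw [← hz, hc2, ← hca])) hq.symm
    have hbi : b = i := by
      rcases mem_of_mE_eq_mE D hD2 h (Or.inr (Or.inr rfl)) with hb | hb | hb
      · exact hb.symm
      · exact absurd (by rw [← hb, hc1, hca]) hq
      · exact absurd (by rw [← hb, hc2, hca]) hq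
    exact hbz (hbi.trans hzi.symm)

/-- **Case I.3, `D = 3`**: a cross `x_i^2 x_j` is invariant and `k` is an index whose eigenvalue
differs from `c_i` and `c_j`: then `x_i x_{j₀(i)} x_k` is bad and outside the range. [folklore] -/
private theorem extra_caseI_three_3 (hc : ∀ i, c i ≠ 0) (hD3 : D = 3) {i j : Fin m}
    (hij : c i ≠ c j) (hA : c i ^ (D - 1) * c j = 1) {k : Fin m} (hki : c k ≠ c i)
    (hkj : c k ≠ c j) : ∃ e ∈ bad c D, ∀ q ∈ cross c, iota c D q ≠ e := by
  have hz := jz_spec c D hA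
  have hczj : c (jz c D i) = c j := eq_of_goodA_of_goodA hc hz hA
  have hiz : i ≠ jz c D i := fun h => hij (by rw [h, hczj])
  have hik : i ≠ k := fun h => hki (by rw [h])
  have hzk : jz c D i ≠ k := fun h => hkj (by rw [← h, hczj])
  refine ⟨mE D i (jz c D i) k, (mem_bad_iff c D).mpr ⟨degree_mE D (by omega) _ _ _,
    fun h => hki ?_⟩, ?_⟩
  · rw [chi_mE] at h
    exact (eq_of_goodA_of_goodE hc (by omega) hz h).symm
  rintro ⟨a, b⟩ hq h
  rw [mem_cross_iff] at hq
  dsimp only at hq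
  obtain ⟨-, hbz, hsh, hcz, -⟩ := iota_eq_mE_of_eq_triple c D hc hD3 hiz hik hzk hq h
  rw [hsh] at h
  have hD2 : D - 2 = 1 := by omega
  -- `j₀(a)` and `b` are two DISTINCT elements of `{i, j₀(i), k}` with the same eigenvalue: impossible
  have hz' := mem_of_mE_eq_mE D hD2 h (Or.inr (Or.inl rfl))
  have hb' := mem_of_mE_eq_mE D hD2 h (Or.inr (Or.inr rfl))
  rcases hz' with hz' | hz' | hz' <;> rcases hb' with hb' | hb' | hb'
  · exact hbz (hb'.symm.trans hz')
  · exact hij (by rw [hz', hcz, ← hb', hczj])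
  · exact hki (by rw [hz', hcz, hb'])
  · exact hij (by rw [← hczj, hz', hcz, hb'])
  · exact hbz (hb'.symm.trans hz')
  · exact hkj (by rw [hb', ← hcz, ← hz', hczj])
  · exact hki (by rw [hz', hcz, ← hb'])
  · exact hkj (by rw [hz', hcz, ← hb', hczj])
  · exact hbz (hb'.symm.trans hz')

/-- **Case I.3, `D = 3`, the third class exists**: if the class of `i` is `{i}` and at most one
index other than `j₀(i)` has `x_i^2 x_·` invariant, then (`m ≥ 4`) some index has an eigenvalue
different from `c_i` and `c_j`. [folklore] -/
private theorem exists_third_class {i j : Fin m} (hA : c i ^ (D - 1) * c j = 1) (hm4 : 4 ≤ m)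
    (hI1 : ¬ ∃ i', i' ≠ i ∧ c i' = c i)
    (hI2 : ¬ ∃ j₁ j₂, j₁ ≠ j₂ ∧ j₁ ≠ jz c D i ∧ j₂ ≠ jz c D i ∧
      c i ^ (D - 1) * c j₁ = 1 ∧ c i ^ (D - 1) * c j₂ = 1) :
    ∃ k, c k ≠ c i ∧ c k ≠ c j := by
  classical
  by_contra hk
  apply hI2
  -- every index other than `i` lies in the class `T` of `j`
  set T := Finset.univ.filter fun x : Fin m => c x = c j with hT
  have hmem : ∀ x, x ≠ i → x ∈ T := by
    intro x hx
    rw [hT, Finset.mem_filter]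
    refine ⟨Finset.mem_univ x, ?_⟩
    by_contra hxj
    by_cases hxi : c x = c i
    · exact hI1 ⟨x, hx, hxi⟩
    · exact hk ⟨x, hxi, hxj⟩
  have hsub : Finset.univ.erase i ⊆ T := fun x hx => hmem x (Finset.ne_of_mem_erase hx)
  have hcard : 3 ≤ T.card := by
    have h1 := Finset.card_le_card hsub
    rw [Finset.card_erase_of_mem (Finset.mem_univ i), Finset.card_univ, Fintype.card_fin] at h1
    omega
  have h2 : 1 < (T.erase (jz c D i)).card := by
    have := Finset.pred_card_le_card_erase (s := T) (a := jz c D i)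
    omega
  obtain ⟨j₁, hj₁, j₂, hj₂, h12⟩ := Finset.one_lt_card.mp h2
  rw [Finset.mem_erase, hT, Finset.mem_filter] at hj₁ hj₂
  refine ⟨j₁, j₂, h12, hj₁.1, hj₂.1, ?_, ?_⟩
  · rw [hj₁.2.2]; exact hA
  · rw [hj₂.2.2]; exact hA

/-- **One more bad monomial**: some bad monomial of degree `D` is not of the form `ι(q)`
(`D ≥ 3`, `m ≥ 3`, `(D,m) ≠ (3,3)`, `c` not constant). [folklore] -/
private theorem exists_bad_forall_iota_ne (hc : ∀ i, c i ≠ 0) (hD : 3 ≤ D) (hm : 3 ≤ m)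
    (h33 : D = 3 → 4 ≤ m) (hne : ∃ i j, c i ≠ c j) :
    ∃ e ∈ bad c D, ∀ q ∈ cross c, iota c D q ≠ e := by
  classical
  by_cases hI : ∃ i j, c i ≠ c j ∧ c i ^ (D - 1) * c j = 1
  · obtain ⟨i, j, hij, hA⟩ := hI
    by_cases hD4 : 4 ≤ D
    · exact extra_caseI_four c D hc hD4 hij hA
    have hD3 : D = 3 := by omega
    by_cases hI1 : ∃ i', i' ≠ i ∧ c i' = c i
    · obtain ⟨i', hi'i, hci'⟩ := hI1
      exact extra_caseI_three_1 c D hc hD3 hij hA hi'i hci'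
    by_cases hI2 : ∃ j₁ j₂, j₁ ≠ j₂ ∧ j₁ ≠ jz c D i ∧ j₂ ≠ jz c D i ∧
        c i ^ (D - 1) * c j₁ = 1 ∧ c i ^ (D - 1) * c j₂ = 1
    · obtain ⟨j₁, j₂, h12, h1z, h2z, hA1, hA2⟩ := hI2
      exact extra_caseI_three_2 c D hc hD3 hij hA h12 h1z h2z hA1 hA2
    obtain ⟨k, hki, hkj⟩ := exists_third_class c D hA (h33 hD3) hI1 hI2
    exact extra_caseI_three_3 c D hc hD3 hij hA hki hkj
  · have hII : ∀ a b : Fin m, c a ≠ c b → c a ^ (D - 1) * c b ≠ 1 :=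
      fun a b hab hA => hI ⟨a, b, hab, hA⟩
    obtain ⟨i, j, hij⟩ := hne
    by_cases hD4 : 4 ≤ D
    · exact extra_caseII_four c D hc hD4 hm hII hij
    · exact extra_caseII_three c D hc (by omega) (h33 (by omega)) hII hij

/-- **The count**: there are more bad monomials than cross pairs. [folklore] -/
private theorem card_cross_lt_card_bad (hc : ∀ i, c i ≠ 0) (hD : 3 ≤ D) (hm : 3 ≤ m)
    (h33 : D = 3 → 4 ≤ m) (hne : ∃ i j, c i ≠ c j) : (cross c).card < (bad c D).card := by
  classical
  obtain ⟨e, he, hne'⟩ := exists_bad_forall_iota_ne c D hc hD hm h33 hne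
  rw [← Finset.card_image_of_injOn (iota_injOn c D hc hD)]
  refine Finset.card_lt_card ⟨Finset.image_subset_iff.mpr ?_, fun h => ?_⟩
  · rintro ⟨a, b⟩ hq
    exact iota_mem_bad c D hc (by omega) ((mem_cross_iff c).mp hq)
  · obtain ⟨q, hq, hqe⟩ := Finset.mem_image.mp (h he)
    exact hne' q hq hqe

end InvariantMonomialCount

open InvariantMonomialCount in
/-- **Invariant monomials versus cross pairs** (the combinatorial core of the dimension count behind
"almost all `w ∈ Sym^D ℂ^m` have a trivial stabilizer", BI 2017 §2.1 after Matsumura–Monsky):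
for a tuple `c` of nonzero scalars that is not constant and `D ≥ 3`, `m ≥ 3`, `(D,m) ≠ (3,3)`,
the number of degree-`D` monomials `x^e` with `c^e = 1` plus the number of ordered pairs `(i,j)`
with `c_i ≠ c_j` is less than the number of all degree-`D` monomials in `m` variables.
[cite: BurgisserIkenmeyer2017, §2.1 ("almost all w ∈ Sym^D ℂ^m have a trivial stabilizer")] -/
theorem card_invariant_add_card_cross_lt {m D : ℕ} {K : Type*} [Field K] [DecidableEq K]
    (c : Fin m → K) (hc : ∀ i, c i ≠ 0) (hD : 3 ≤ D) (hm : 3 ≤ m) (h33 : D = 3 → 4 ≤ m)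
    (hne : ∃ i j, c i ≠ c j) :
    ((degMonomials (Fin m) D).filter fun e => (e.prod fun i k => c i ^ k) = 1).card +
      (Finset.univ.filter fun q : Fin m × Fin m => c q.1 ≠ c q.2).card <
      (degMonomials (Fin m) D).card := by
  have h1 := Finset.card_filter_add_card_filter_not
    (s := degMonomials (Fin m) D) (fun e => (e.prod fun i k => c i ^ k) = 1)
  have h2 : (Finset.univ.filter fun q : Fin m × Fin m => c q.1 ≠ c q.2).card <
      ((degMonomials (Fin m) D).filter fun e => ¬ (e.prod fun i k => c i ^ k) = 1).card :=
    card_cross_lt_card_bad c D hc hD hm h33 hne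
  omega



end Literature.Computability.AlgebraicComplexity
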